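import Summits.BirchSwinnertonDyer.BirchSwinnertonDyer.Theorems.ErratumRoadFiveNonSurjCornerHybridOneModResidual
import Summits.BirchSwinnertonDyer.BirchSwinnertonDyer.Theorems.ErratumRoadFiveEulerHalfNotRamLevelLoweringCut
import HarnessLib

/-!
# Route `ErratumRoadFive` (rung K2), crux `NonSurjCorner` (item stmt-BirchSwinnertonDyer-19065), registered line `Lines/hybrid.lean`:
# GLUE #15 — glue #14 with THE LEVEL-LOWERING CUT on the structural residual: on the (T4′) corner EVERY multiplicative prime is a `p`-carrier
# (`¬ Ram` and `p ∣ ord_p Δ_min` are hypotheses of the crux), so `E[p]` is finite at `p` and unramified at every multiplicative prime, its Serre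
# level divides the additive conductor, and the genus-zero additive loci (`N_add ∈ {1, 2, 4, 8, 16}`, `{1, 3, 9}`, `{1, 5, 25}`) are EXCLUDED by
# Ribet–Diamond level lowering — bsd-line-er5-p1 g1's `EulerHalfLevelLoweringCut.not_dvd_ordp_of_genusZeroAdditive_of_not_ram` (idea-9 g3's cut),
# priced by two printed facts BY NAME (Diamond 1995 refined Serre; Ogg–Saito) — RULING 58 (a): slot 7 stays ONE object with 19715's after-cuts residual
# (cell `bsd-stepL`, seat `bsd-stepL-corner-p1` g17; `--supports stmt-BirchSwinnertonDyer-19065 --as helper`)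

WHY THIS FILE. Glue #14 (`…HybridOneModResidual`) leaves the structural residual «three distinct split multiplicative `q_i ≠ p`, all `≡ 1 (mod p)`»
(`hres3oneMod`). The lead of 19715's line landed the LEVEL-LOWERING CUT (`…EulerHalfNotRamLevelLoweringCut`, from bsd-idea-9 g3's crux workfile): for
`p ≥ 5` multiplicative with `E[p]` irreducible and NO (ram) prime, `p ∣ ord_p(Δ_min)` is IMPOSSIBLE when the additive part of the conductor is `1`, a
power of `2` dividing `16`, `9` or `25` (Serre weight 2, Serre level `∣ N_add`, trivial nebentypus as `p ∤ φ(M)`, `S₂(Γ₀(M)) = 0`). On the corner both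
`¬ Ram W p` and `p ∣ ord_p Δ_min` are HYPOTHESES of the crux (and automatic from `¬ Surj` anyway), so the cut applies corner-wide with no exhaustion
lemma: THIS FILE = glue #14 with the residual binder asked only OFF the three genus-zero additive loci (`hres3oneModOffGenusZero`: three extra negated
hypotheses, the loci VERBATIM as in `not_dvd_ordp_of_genusZeroAdditive_of_not_ram`), priced by ONE new citable conjunct pair
`hLLOS : diamond1995_refinedSerre ∧ (∀ W ℓ, W.artinConductorExponent_tate_eq_conductorExponent_of_isElliptic ℓ)` (conjunct 3 of slot 5 in r13 — the
same two names 19715 v11 takes; Ogg–Saito is a tree theorem off residue characteristics 2, 3 —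
`artinConductorExponent_tate_eq_conductorExponent_of_isElliptic_of_forall_not_hasAdditiveReductionAt` — but the lead's uniform wrapper asks it by name):
* **glue #15 `nonSurjCorner_of_kolyZShaAn_of_twinMuAn_of_sixteenFacts_of_hidaFacts_of_sixNamedInputs_of_carrierLabelsB6_of_levelLoweringCut_of_threeOneModSplitOffGenusZero`**;
* **`threeOneModSplitOffGenusZero_of_threeOneModSplit`** — r12's slot-7 text implies the cut one (extra hypotheses are dropped), so registering r13
  loses nothing.
Candidate composition of `Lines/hybrid.lean` r13 (slot 7 ↦ `stub_threeSplitOneModOffGenusZero57`; slot 5 gains conjunct 3; slots 1–4, 6 ≡ r12).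
CENSUS: 0 known corner pairs in either residual (every known pair has at most two split multiplicative primes `≠ p`); class-wide the gain is every
conductor whose additive part is `2^a` (`a ≤ 4`), `9` or `25` — there the residual is now provably empty.

HONEST FRAMING: TWO THEOREMS (no definition, no named fact, no `sorry`); CONDITIONAL on every displayed binder (as glue #14, plus Diamond 1995 ∕
Ogg–Saito by name); item 19065 is NOT closed; no stub is discharged; nothing about any curve's BSD; BSD is not advanced; T7. Credit: bsd-idea-9 g3
(the cut), bsd-line-er5-p1 g1 (the Theorems file), planner g40 (RULING 58), and the credits of glue #14.
References (locators only): [cite: Ribet1990, Thm. 1.1] [cite: Diamond1995RefinedSerre, Thm. 1.1] [cite: Serre1987, §2.8 Prop. 4, §4.1 (4.1.12)]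
[cite: DiamondShurman2005, Thm. 3.5.1] [cite: SilvermanATAEC1994, Thm. IV.10.2, IV.11.1] [cite: PastenShimura2024, Lemma 6.18] [cite: Jetchev2008, Thm. 1.1, Cor. 1.5]
[cite: Kato2004Asterisque, §17.13] [cite: Miller2011LMS, Def. 1.1].
-/

set_option autoImplicit false
set_option linter.dupNamespace false -- `Summit.BirchSwinnertonDyer.BirchSwinnertonDyer` (summit = problem), tree-wide

noncomputable section

open scoped Classical NumberField MatrixGroups ModularForm

namespace Summit.BirchSwinnertonDyer.BirchSwinnertonDyer.Theorems

open CongruenceSubgroup WeierstrassCurve NumberField IsDedekindDomain Field Rat.HeightOneSpectrum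
  Literature.NumberTheory.EllipticCurves
  Literature.NumberTheory.EllipticCurves.ModularForms
  Literature.NumberTheory.Automorphic
  Literature.NumberTheory.EllipticCurves.Rank1Residual
  Literature.NumberTheory.EllipticCurves.Rank1Residual.Typed
  Literature.NumberTheory.EllipticCurves.Wuthrich2014
  Literature.NumberTheory.EllipticCurves.SteinWuthrich2013
  Literature.NumberTheory.EllipticCurves.Greenberg1999
  Literature.NumberTheory.EllipticCurves.Kato2004
  Literature.NumberTheory.EllipticCurves.BarriosEtAl2025
  Literature.NumberTheory.EllipticCurves.EmertonPollackWeston2006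
  Literature.NumberTheory.EllipticCurves.ShimuraCMFamily
  Literature.NumberTheory.GaloisRepresentations Literature.NumberTheory.GaloisCohomology
  Summit.BirchSwinnertonDyer.Rank1Residual
  Summit.BirchSwinnertonDyer.Rank1Residual.X11b
  Summit.BirchSwinnertonDyer.Rank1Residual.X11b.Three.Koly

/-- **THE HYBRID GLUE (glue #15) — THE LEVEL-LOWERING CUT ON THE RESIDUAL.** As glue #14 (`…HybridOneModResidual`) with the residual binder asked
only OFF the genus-zero additive loci (`hres3oneModOffGenusZero`: «not (every prime `≠ 2` semistable ∧ `2⁵ ∤ N`)», «not (every prime `≠ 3` semistable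
∧ `3³ ∤ N`)», «not (every prime `≠ 5` semistable ∧ `5³ ∤ N`)» as three extra hypotheses) and one new citable pair `hLLOS` (Diamond 1995 refined Serre ∧
Ogg–Saito, BY NAME); on the loci the corner pair cannot exist (`EulerHalfLevelLoweringCut.not_dvd_ordp_of_genusZeroAdditive_of_not_ram` contradicts
`p ∣ ord_p Δ_min`). Binders: `hZan` → 19948 → `hF″` → `hHida` → hMax → hShim5 → `hLLOS` → `hLabB6T` → `hres3oneModOffGenusZero` → `NonSurjCorner`.
CONDITIONAL on every binder; 19065 NOT closed; nothing booked; T7.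
[cite: Ribet1990, Thm. 1.1] [cite: Diamond1995RefinedSerre, Thm. 1.1] [cite: PastenShimura2024, Lemma 6.18] [cite: Jetchev2008, Thm. 1.1 and Cor. 1.5]
[cite: Kato2004Asterisque, §17.13 (pp. 279–280)] [cite: Mazur1978, Cor. 4.1] [cite: EmertonPollackWeston2006, Thm. 5.1.3] [cite: Miller2011LMS, Def. 1.1] -/
theorem nonSurjCorner_of_kolyZShaAn_of_twinMuAn_of_sixteenFacts_of_hidaFacts_of_sixNamedInputs_of_carrierLabelsB6_of_levelLoweringCut_of_threeOneModSplitOffGenusZero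
    (hZan : ∀ (W : WeierstrassCurve ℚ) [W.IsElliptic] [W.IsGloballyMinimal] (p : ℕ) [Fact p.Prime]
      (N : ℕ) [NeZero N] (K : Type) [Field K] [NumberField K]
      (Dt : ModularParametrizationData W N) (β : ℤ) (ι : K →+* ℂ),
      ClassX11b W p → ¬ Surj W p → (p = 5 ∨ p = 7) → p ∣ padicValInt p W.minimalDiscriminantInt →
      ¬ Ram W p → (∃ s : ℚ, shaAn W = (s : ℂ) ∧ 0 < padicValRat p s) →
      W.conductorNorm ℤ = N → IsImaginaryQuadratic K →
      4 < (NumberField.discr K).natAbs → SatisfiesHeegnerHypothesis N K →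
      SatisfiesHeegnerHypothesis p K → (4 * (N : ℤ)) ∣ β ^ 2 - NumberField.discr K → ¬ (p : ℤ) ∣ Dt.c →
      (∃ (d₁ : KolyvaginHeegnerData Dt β ι 1) (y : (W.baseChange K).toAffine.Point),
        WeierstrassCurve.Affine.Point.map (W' := W) (algebraMap K (ringClassField K ι 1)).toRatAlgHom y =
          d₁.derivedPoint ∧
        ∃ Q : (W.baseChange K).toAffine.Point, ((p ^ (padicValNat p W.tamagawaProduct + 1) : ℕ) : ℤ) • Q = y) →
      ∃ M : ℕ, M ≤ padicValNat p W.tamagawaProduct ∧ CertificateAt Dt β ι p M)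
    (hμ : NonSurjCornerTwinMuAn)
    -- slot 3 (r11): SIXTEEN named facts — r9 ∕ r10's twenty-three minus the seven tree theorems {5, 7, 10, 11, 17, 21, 22}
    (hF'' :
      (∀ (N : ℕ) [NeZero N] (W : WeierstrassCurve ℚ) (K : Type) [Field K] [NumberField K], Literature.NumberTheory.EllipticCurves.gross_zagier N W K) ∧
      (∀ (N : ℕ) [NeZero N] (W : WeierstrassCurve ℚ) (K : Type) [Field K] [NumberField K], Literature.NumberTheory.EllipticCurves.kolyvagin N W K) ∧
      Literature.NumberTheory.EllipticCurves.Wuthrich2014.sha_dvd_analyticSha ∧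
      Literature.NumberTheory.EllipticCurves.rank_eq_analyticRank_of_analyticRank_le_one ∧
      Literature.NumberTheory.EllipticCurves.ModularForms.exists_isNewformOf ∧
      Literature.NumberTheory.EllipticCurves.friedbergHoffstein_exists_heegnerField_split_twist_ne_zero ∧
      Literature.NumberTheory.EllipticCurves.ModularForms.mazur_not_dvd_maninConstant_of_odd ∧
      Literature.NumberTheory.EllipticCurves.SteinWuthrich2013.thm61_splitMultiplicative ∧
      Literature.NumberTheory.EllipticCurves.SteinWuthrich2013.thm61_nonsplitMultiplicative ∧
      (∀ (W : WeierstrassCurve ℚ) [W.IsElliptic] [W.IsGloballyMinimal] (p : ℕ) [Fact p.Prime], Literature.NumberTheory.EllipticCurves.greenberg_stevens (W := W) (p := p)) ∧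
      Literature.NumberTheory.EllipticCurves.Cha2005.rmk25_pow_dvd_card_sha_primary_of_certificate ∧
      Literature.NumberTheory.EllipticCurves.Cha2005.rmk25_padicValNat_card_sha_primary_add_le_of_globalDivisibility ∧
      Literature.NumberTheory.EllipticCurves.Kato2004.thm12_4 ∧
      Literature.NumberTheory.EllipticCurves.Kato2004.exists_multDivisibilityInputs_nonsplit_contra ∧
      Literature.NumberTheory.EllipticCurves.Kato2004.exists_multDivisibilityInputs_split_contra ∧
      Literature.NumberTheory.EllipticCurves.Kato2004.exists_multDivisibilityInputs_fine_contra)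
    -- slot 4 (r7): the six Hida-side NAMED facts of x11a's non-surjective chain
    (hHida : EmertonPollackWeston2006.thm311_cotorsion_weightK_member_ofLevel ∧
      EmertonPollackWeston2006.thm1_muAlg_of_weightK_member_ofLevel ∧
      Wan2015.thm4_rational_weightK_member_of_bdd_ofLevel_irred ∧
      EmertonPollackWeston2006.thm513_transfer_from_weightK_member_of_bdd_ofLevel ∧
      DeligneSerre1974.thm61_exists_adicGaloisRep ∧ Hida2000_thm326_ordinary)
    (hMax : GrossLMS1991.prop37_2_frobeniusCongruence ∧
      (∀ (K : Type) [Field K] [NumberField K], poitouTate_selmerStructure_duality_conj K) ∧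
      Gross1991_heegnerPoint_sub_ratTorsion_mem_E0_imageFree)
    -- slot 5, conjunct 2 (r12): FIVE named inputs of the Shimura roads — `shimuraCurve_heegnerSystem_primitivesSplitReduced` (the split-`p` road's
    -- CM primitives) is IDLE once `2` may pair: the datum₂ lemma always places `p` in the inert set (`p ∤ p − 1`), so the split road is never taken
    (hShim5 : friedbergHoffstein_exists_twist_ne_zero_inertAt ∧ nonempty_shimuraParametrizationData ∧
      PastenShimura2024_componentOrders ∧
      (∀ (K : Type) [Field K] [NumberField K], casselsTate_levelInputs K) ∧
      shimuraCurve_heegnerSystem_primitivesFromFiveIrr)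
    -- slot 5, conjunct 3 (r13): the two printed inputs of the level-lowering cut, BY NAME (as on 19715's line)
    (hLLOS : diamond1995_refinedSerre ∧
      ∀ (W : WeierstrassCurve ℚ) (ℓ : ℕ) [Fact ℓ.Prime], W.artinConductorExponent_tate_eq_conductorExponent_of_isElliptic ℓ)
    -- slot 6 (r10): the labelled CM family at the corner's inert frames with `d_K < −4`, WITH (B6) ONLY AT THE CARRIER PRIMES outside `S`
    (hLabB6T : ∀ (W : WeierstrassCurve ℚ) [W.IsElliptic] [W.IsGloballyMinimal] (p : ℕ) [Fact p.Prime],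
      ClassX11b W p → ¬ Surj W p → (p = 5 ∨ p = 7) →
      ∀ (N : ℕ) [NeZero N] (K : Type) [Field K] [NumberField K] (S : Finset ℕ) (Dt : ModularParametrizationData W N)
        (X : ShimuraCurveData (∏ q ∈ S, q) (N / ∏ q ∈ S, q)) (W' : WeierstrassCurve ℚ) [W'.IsElliptic]
        (P₀ : ShimuraParametrizationData X W'),
        W.conductorNorm ℤ = N → IsImaginaryQuadratic K → NumberField.discr K < -4 → Even S.card →
        (∀ ℓ ∈ S, ℓ.Prime ∧ ℓ ∣ N ∧ ¬ ℓ ^ 2 ∣ N ∧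
          ((Ideal.span {(ℓ : ℤ)}).primesOver (𝓞 K)).ncard = 1 ∧ ¬ (ℓ : ℤ) ∣ NumberField.discr K) →
        (∀ ℓ : ℕ, ℓ.Prime → ℓ ∣ N → ℓ ∉ S → ((Ideal.span {(ℓ : ℤ)}).primesOver (𝓞 K)).ncard = 2) →
        p ∈ S → ¬ (p : ℤ) ∣ Dt.c → P₀.IsMinimalFor W →
        ∃ (ι : K →+* ℂ) (y : (W.baseChange K).toAffine.Point) (degy : ℕ)
          (ys : (m : ℕ) → (W.baseChange (ringClassField K ι m)).toAffine.Point) (ε : ℤ), 0 < degy ∧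
          padicValNat p degy = padicValNat p P₀.deg ∧
          LDerivEK W K = 8 * (Real.pi : ℂ) ^ 2 * peterssonProduct (CongruenceSubgroup.Gamma0 N) 2 Dt.f Dt.f /
              ((((Units.torsionOrder K : ℝ) / 2) ^ 2 * √|(NumberField.discr K : ℝ)| : ℝ) : ℂ) *
            ((y.canonicalHeight : ℂ) / (degy : ℂ)) ∧
          (¬ IsOfFinAddOrder y → 0 < (AddSubgroup.zmultiples y).index) ∧
          ShimuraWalk.LabelsAt W N K ι y ys ε ∧
          ∀ (q : ℕ) [Fact q.Prime], q ∣ N → q ∉ S → p ∣ (W.baseChange ℚ_[q]).localTamagawaNumber ℤ_[q] → LabelB6 ι W N {q} ys)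
    -- slot 7 (r13): the structural residual OFF the genus-zero additive loci (the level-lowering cut), bad clause `p ∣ q_i − 1` only
    (hres3oneModOffGenusZero : ∀ (W : WeierstrassCurve ℚ) [W.IsElliptic] [W.IsGloballyMinimal] (p : ℕ) [Fact p.Prime],
      ClassX11b W p → ¬ Surj W p → (p = 5 ∨ p = 7) → p ∣ padicValInt p W.minimalDiscriminantInt → ¬ Ram W p →
      ¬ ((∀ (ℓ : ℕ) [Fact ℓ.Prime], ℓ ≠ 2 → W.HasGoodReductionAtPrime ℓ ∨ W.HasMultiplicativeReductionAtPrime ℓ) ∧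
          ¬ 2 ^ 5 ∣ W.conductorNorm ℤ) →
      ¬ ((∀ (ℓ : ℕ) [Fact ℓ.Prime], ℓ ≠ 3 → W.HasGoodReductionAtPrime ℓ ∨ W.HasMultiplicativeReductionAtPrime ℓ) ∧
          ¬ 3 ^ 3 ∣ W.conductorNorm ℤ) →
      ¬ ((∀ (ℓ : ℕ) [Fact ℓ.Prime], ℓ ≠ 5 → W.HasGoodReductionAtPrime ℓ ∨ W.HasMultiplicativeReductionAtPrime ℓ) ∧
          ¬ 5 ^ 3 ∣ W.conductorNorm ℤ) →
      ∀ (q₁ q₂ q₃ : ℕ) [Fact q₁.Prime] [Fact q₂.Prime] [Fact q₃.Prime], q₁ ≠ p → q₂ ≠ p → q₃ ≠ p →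
      q₁ ≠ q₂ → q₁ ≠ q₃ → q₂ ≠ q₃ →
      W.HasSplitMultiplicativeReductionAtPrime q₁ → W.HasSplitMultiplicativeReductionAtPrime q₂ →
      W.HasSplitMultiplicativeReductionAtPrime q₃ →
      p ∣ q₁ - 1 → p ∣ q₂ - 1 → p ∣ q₃ - 1 → Typed.MissingUpperBoundAt W p) :
    Summit.BirchSwinnertonDyer.BirchSwinnertonDyer.Theses.ErratumRoadFive.NonSurjCorner := by
  obtain ⟨hGZ, hKo, hWu, hGZK, hnf, hFHs, hMaz, hJs, hJn, hGS, hChaL, hChaU, h12, hns', hsp', hfine'⟩ := hF''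
  obtain ⟨h311, hT1a, hT2, hT1b, h61, h326⟩ := hHida
  obtain ⟨h37, hPTs, hF1⟩ := hMax
  obtain ⟨hFH, hJL, hCO, hCT, hLab⟩ := hShim5
  obtain ⟨hLL, hOS⟩ := hLLOS
  -- the seven former slot-3 conjuncts that are THEOREMS of the tree
  have hmod : hasEntireLFunction_rat := hasEntireLFunction_rat_of_exists_isNewformOf hnf
  have hpar : nonempty_modularParametrizationData :=
    nonempty_modularParametrizationData_of_exists_isNewformOf hnf IsNewformOf.exists_maninConstant_ne_zero_holds
  have hrec : ∀ (N : ℕ) [NeZero N] (W : WeierstrassCurve ℚ) (K : Type) [Field K] [NumberField K],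
      heegnerPointOfConductor_one_galoisConj N W K :=
    fun N _ W K _ _ ↦ heegnerPointOfConductor_one_galoisConj_holds N W K
  have hD36 : ∀ (N : ℕ) [NeZero N] (W : WeierstrassCurve ℚ) (K : Type) [Field K] [NumberField K],
      phi_heegnerTau_mem_singularModuliField N W K :=
    fun N _ W K _ _ ↦ phi_heegnerTau_mem_singularModuliField_holds N W K
  have hPT : ∀ (K : Type) [Field K] [NumberField K],
      Literature.NumberTheory.GaloisCohomology.poitouTate_sum_localTatePairing_eq_zero K :=
    poitouTate_sum_localTatePairing_eq_zero_holds
  have hBR : localTamagawaNumber_quadraticTwist_two_mem_of_goodReduction :=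
    BarriosEtAl2025.localTamagawaNumber_quadraticTwist_two_mem_of_goodReduction_holds
  -- slot 4: the leaf-twin lower half from 19948 + named facts (the `_of_mazur` Hida doors: no Greenberg 1.5, no Cor. 18)
  have h₄ℓ : ∀ (Wd : WeierstrassCurve ℚ) [Wd.IsElliptic] [Wd.IsGloballyMinimal] (p : ℕ) [Fact p.Prime],
      ClassX11a Wd p → ¬ Surj Wd p → (p = 5 ∨ p = 7) → p ∣ padicValInt p Wd.minimalDiscriminantInt →
      ¬ X11a.ShaAnUnit Wd p → Typed.MissingLowerBoundAt Wd p :=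
    fun Wd _ _ p _ hXa hnsd h57 _ _ ↦
      NonSurjChain.lowerNonSurj_fiveSeven_of_nonSurjCornerTwinMuAn_of_contraFacts_of_mazur hnf h311 hT1a hT2 hT1b h61 h326 h12 hns'
        hsp' hfine' hMaz hJs hJn hGZK hGS hμ Wd p hXa hnsd h57
  -- slot 6 (r10): the SAVED display in D-form at every corner pair and every `q₁`, from the labels with (B6) at the CARRIERS, Poitou–Tate and CT
  have hSavD : ∀ (W : WeierstrassCurve ℚ) [W.IsElliptic] [W.IsGloballyMinimal] (p : ℕ) [Fact p.Prime],
      ClassX11b W p → ¬ Surj W p → (p = 5 ∨ p = 7) → ∀ (q₁ : ℕ) [Fact q₁.Prime], ShimuraInertSavedDisplayAtD W p q₁ :=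
    NonSurjCorner.shimuraInertSavedDisplayAtD_of_carrierLabelsB6 hPTs hCT hLabB6T
  exact X11b.erratumRoadFive_nonSurjCorner_of_kolyZShaAn_of_kolyJMax_of_multiUpper_of_lowerLeafTwinDeep_of_twinMultDivisibility hGZ hKo
    hWu hGZK hmod hnf hpar hFHs hMaz hrec hD36 hJs hJn hGS hChaL hChaU h₄ℓ hZan
    (X11b.Three.Koly.nonSurjCornerKolyJ_max_of_threeNamedFacts h37 hPTs hF1)
    (fun W _ _ p _ hX hns' h57 hv hnr htam hmulti ↦ by
      -- the TWIN-LOWER SUPPLY at this corner pair (Friedberg–Hoffstein + the leaf-twin lower half)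
      have hTL : FHTwinLowerSupplyAt W p :=
        NonSurjCorner.fhTwinLowerSupplyAt_of_lowerLeafTwinDeep hGZK hmod hnf hFH h₄ℓ W p hX hns' h57 hv hnr
      by_cases h3 : ∃ (q₁ q₂ q₃ : ℕ) (_ : Fact q₁.Prime) (_ : Fact q₂.Prime) (_ : Fact q₃.Prime), q₁ ≠ p ∧ q₂ ≠ p ∧ q₃ ≠ p ∧
          q₁ ≠ q₂ ∧ q₁ ≠ q₃ ∧ q₂ ≠ q₃ ∧ W.HasSplitMultiplicativeReductionAtPrime q₁ ∧
          W.HasSplitMultiplicativeReductionAtPrime q₂ ∧ W.HasSplitMultiplicativeReductionAtPrime q₃ ∧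
          p ∣ q₁ - 1 ∧ p ∣ q₂ - 1 ∧ p ∣ q₃ - 1
      · obtain ⟨q₁, q₂, q₃, i₁, i₂, i₃, h1p, h2p, h3p, h12', h13, h23, hs1, hs2, hs3, hb1, hb2, hb3⟩ := h3
        haveI := i₁; haveI := i₂; haveI := i₃
        -- the level-lowering cut: on the genus-zero additive loci the corner pair cannot exist
        have hp5 : 5 ≤ p := by rcases h57 with rfl | rfl <;> norm_num
        by_cases hloc : ((∀ (ℓ : ℕ) [Fact ℓ.Prime], ℓ ≠ 2 → W.HasGoodReductionAtPrime ℓ ∨ W.HasMultiplicativeReductionAtPrime ℓ) ∧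
              ¬ 2 ^ 5 ∣ W.conductorNorm ℤ) ∨
            ((∀ (ℓ : ℕ) [Fact ℓ.Prime], ℓ ≠ 3 → W.HasGoodReductionAtPrime ℓ ∨ W.HasMultiplicativeReductionAtPrime ℓ) ∧
              ¬ 3 ^ 3 ∣ W.conductorNorm ℤ) ∨
            ((∀ (ℓ : ℕ) [Fact ℓ.Prime], ℓ ≠ 5 → W.HasGoodReductionAtPrime ℓ ∨ W.HasMultiplicativeReductionAtPrime ℓ) ∧
              ¬ 5 ^ 3 ∣ W.conductorNorm ℤ)
        · exact absurd hv (EulerHalfLevelLoweringCut.not_dvd_ordp_of_genusZeroAdditive_of_not_ram hnf hLL hOS W p hp5 hX.2.2.1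
            hX.2.2.2 hnr hloc)
        · exact hres3oneModOffGenusZero W p hX hns' h57 hv hnr (fun h ↦ hloc (Or.inl h)) (fun h ↦ hloc (Or.inr (Or.inl h)))
            (fun h ↦ hloc (Or.inr (Or.inr h))) q₁ q₂ q₃ h1p h2p h3p h12' h13 h23 hs1 hs2 hs3 hb1 hb2 hb3
      · exact NonSurjCorner.missingUpperBoundAt_of_savedDisplayD_of_twinLower_of_not_threeOneModSplit hGZK hmod hnf hMaz hBR hJL hCO hPT
          hCT hLab W p hX hns' h57 htam hmulti hTL (fun q₁ _ ↦ hSavD W p hX hns' h57 q₁)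
          (fun q₁ q₂ q₃ _ _ _ h1p h2p h3p h12' h13 h23 hs1 hs2 hs3 hb1 hb2 hb3 ↦
            h3 ⟨q₁, q₂, q₃, inferInstance, inferInstance, inferInstance, h1p, h2p, h3p, h12', h13, h23, hs1, hs2, hs3,
              hb1, hb2, hb3⟩))
    (fun Wd _ _ p _ hXa hnsd h57 hvd ↦
      X11b.multDivisibilityAt_of_katoFacts_of_muAn_contra_of_mazur Kato2004.nonempty_iwasawaH1Data_holds h12 hnf hns' hsp' hfine'
        hMaz Wd p hXa.2.1 hXa.2.2.1 hXa.2.2.2.1 hnsd (fun f hf ϖ hϖ a L hsa hna hL ↦ hμ Wd p hXa hnsd h57 hvd f hf ϖ hϖ a L hsa hna hL))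

/-- **r12-compatibility of the level-lowering cut.** r12's slot-7 text (`stub_threeSplitOneMod57`) implies the cut text (the three negated-locus
hypotheses are simply dropped). So every proof of the r12 stub is a proof of the r13 stub and registering r13 loses nothing. Bookkeeping; nothing asserted. -/
theorem threeOneModSplitOffGenusZero_of_threeOneModSplit
    (hres3oneMod : ∀ (W : WeierstrassCurve ℚ) [W.IsElliptic] [W.IsGloballyMinimal] (p : ℕ) [Fact p.Prime],
      ClassX11b W p → ¬ Surj W p → (p = 5 ∨ p = 7) → p ∣ padicValInt p W.minimalDiscriminantInt → ¬ Ram W p →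
      ∀ (q₁ q₂ q₃ : ℕ) [Fact q₁.Prime] [Fact q₂.Prime] [Fact q₃.Prime], q₁ ≠ p → q₂ ≠ p → q₃ ≠ p →
      q₁ ≠ q₂ → q₁ ≠ q₃ → q₂ ≠ q₃ →
      W.HasSplitMultiplicativeReductionAtPrime q₁ → W.HasSplitMultiplicativeReductionAtPrime q₂ →
      W.HasSplitMultiplicativeReductionAtPrime q₃ →
      p ∣ q₁ - 1 → p ∣ q₂ - 1 → p ∣ q₃ - 1 → Typed.MissingUpperBoundAt W p) :
    ∀ (W : WeierstrassCurve ℚ) [W.IsElliptic] [W.IsGloballyMinimal] (p : ℕ) [Fact p.Prime],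
      ClassX11b W p → ¬ Surj W p → (p = 5 ∨ p = 7) → p ∣ padicValInt p W.minimalDiscriminantInt → ¬ Ram W p →
      ¬ ((∀ (ℓ : ℕ) [Fact ℓ.Prime], ℓ ≠ 2 → W.HasGoodReductionAtPrime ℓ ∨ W.HasMultiplicativeReductionAtPrime ℓ) ∧
          ¬ 2 ^ 5 ∣ W.conductorNorm ℤ) →
      ¬ ((∀ (ℓ : ℕ) [Fact ℓ.Prime], ℓ ≠ 3 → W.HasGoodReductionAtPrime ℓ ∨ W.HasMultiplicativeReductionAtPrime ℓ) ∧
          ¬ 3 ^ 3 ∣ W.conductorNorm ℤ) →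
      ¬ ((∀ (ℓ : ℕ) [Fact ℓ.Prime], ℓ ≠ 5 → W.HasGoodReductionAtPrime ℓ ∨ W.HasMultiplicativeReductionAtPrime ℓ) ∧
          ¬ 5 ^ 3 ∣ W.conductorNorm ℤ) →
      ∀ (q₁ q₂ q₃ : ℕ) [Fact q₁.Prime] [Fact q₂.Prime] [Fact q₃.Prime], q₁ ≠ p → q₂ ≠ p → q₃ ≠ p →
      q₁ ≠ q₂ → q₁ ≠ q₃ → q₂ ≠ q₃ →
      W.HasSplitMultiplicativeReductionAtPrime q₁ → W.HasSplitMultiplicativeReductionAtPrime q₂ →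
      W.HasSplitMultiplicativeReductionAtPrime q₃ →
      p ∣ q₁ - 1 → p ∣ q₂ - 1 → p ∣ q₃ - 1 → Typed.MissingUpperBoundAt W p :=
  fun W _ _ p _ hX hns h57 hv hnr _ _ _ q₁ q₂ q₃ _ _ _ h1p h2p h3p h12 h13 h23 hs1 hs2 hs3 hb1 hb2 hb3 ↦
    hres3oneMod W p hX hns h57 hv hnr q₁ q₂ q₃ h1p h2p h3p h12 h13 h23 hs1 hs2 hs3 hb1 hb2 hb3

end Summit.BirchSwinnertonDyer.BirchSwinnertonDyer.Theorems

end
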